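import Summits.KontsevichZagierPeriods.KontsevichZagierPeriods.Theorems.FurushoPentagonPentagonInKZChartBAux
import Literature.NumberTheory.Transcendental.DrinfeldAssociatorRegularisation
import Literature.NumberTheory.Transcendental.AssociatorsDefectSeriesProofs
import Literature.NumberTheory.Transcendental.AssociatorsHexagonProofs
import Literature.NumberTheory.Transcendental.AssociatorsEvalProofs

/-!
# `PentagonInKZ` (stmt-KontsevichZagierPeriods-11348), line `logfree-gauge-corner-flatness`:
# stub `stub_chartB` — the chart identity `B(X,W) = A(X,-X-W) e^{λX}`

The registered stub `stub_chartB` of the skeleton of the line `logfree-gauge-corner-flatness`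
(crux `Summit.KontsevichZagierPeriods.KontsevichZagierPeriods.Theses.FurushoPentagon.PentagonInKZ`):
with `B(X,W) := (P 10)(X, W, 0)` the log-free transport of `X ds/s + W ds/(s+1)` over
`s ∈ (0, 1)` and `A(X,Y) := (P 5)(X, Y, 0)` that of `X dτ/τ + Y dτ/(τ-1)` over `τ ∈ (0, ½)`,
both end-regularised at the tangential base point `0` (`Shuffle.regEnd 0`), and
`λ := χ[∫₀^{1/2} dτ/(τ-1)]`, one has `B(X,W) = A(X,-X-W) · e^{λX}` for weight-one `X, W` in every
truncated Drinfeld–Kohno algebra and every realisation `χ` of the Kontsevich–Zagier rules.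

Proof. (a) On words not ending in the letter `0` the coefficients of `B` are classes of
absolutely convergent iterated integrals, and the Möbius chart `s = τ/(1-τ)` (one
change-of-variables move) followed by signed integrand additivity expands each of them as the
signed sum, over the letter substitution `θ : x₀ ↦ x₀ - x₁, x₁ ↦ -x₁`, of coefficients of `A`
(sub-stub `chartB_core` of `…ChartBAux.lean`, instantiated on the atlas in
`ChartB.of_I10_sub_sum_mem_relations`). (b) Restricting to two-letter words (`NCSeries.push`
along the `0/1` matrix of the letter embedding) gives group-like series `G_A, G_B ∈ R⟨⟨x₀,x₁⟩⟩`
(`NCSeries.IsGroupLike.push`); the model `T := θ^*G_A · exp(λ x₀)` (`NCSeries.push NCSeries.mXZ`,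
`Shuffle.expLetter`) is group-like, has, like `G_B`, no coefficient on `x₀` (this is where the
factor `e^{λ x₀}` is forced: `θ^*G_A[x₀] = G_A[x₀] - G_A[x₁] = -λ`), and agrees with `G_B` on the
words not ending in `x₀` by (a); a group-like series `S` with `S[x₀] = 0` is determined by these
values (`Shuffle.pair_regEnd`: `S(W) = ⟨S, regEnd_{x₀} W⟩`), so `G_B = T`. (c) Evaluate:
`evalTrunc` is multiplicative on nilpotent substitutions, `θ^*` becomes the substitution
`(X, W) ↦ (X, -X-W)` (`NCSeries.evalTrunc_push_mXZ`) and `exp(λ x₀) ↦ e^{λX}`.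
This file declares no definitions.

References: M. Kontsevich, D. Zagier, *Periods* (2001), §1.2; K. Ihara, M. Kaneko, D. Zagier,
Compos. Math. 142 (2006), §3 Cor. 5; C. Reutenauer, *Free Lie algebras* (1993), §1.4–1.5.
-/

noncomputable section

open Set MeasureTheory
open Literature.NumberTheory.Transcendental

namespace Summit.KontsevichZagierPeriods.FurushoPentagon.PentagonInKZ

namespace ChartB

/-! ### The convergent-word identity for the path families `I 10`, `I 5` of the atlas -/

/-- Transport of the simplex shape of a representation along `Fin m ≃ Fin n` for `m = n`
(`KZ.IntegralRep.reindex`). [folklore] -/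
theorem reindex_finCongr {m n : ℕ} (h : m = n) (r : KZ.IntegralRep m) (b : ℝ) (c : Fin m → ℝ)
    (hd : r.domain = {t : Fin m → ℝ | (∀ i, 0 < t i ∧ t i < b) ∧ StrictAnti t})
    (hi : EqOn r.integrand (fun t => ∏ i, 1 / (t i - c i)) r.domain) :
    (r.reindex (finCongr h)).domain = {t : Fin n → ℝ | (∀ i, 0 < t i ∧ t i < b) ∧ StrictAnti t} ∧
      EqOn (r.reindex (finCongr h)).integrand (fun t => ∏ i, 1 / (t i - c (Fin.cast h.symm i)))
        {t : Fin n → ℝ | (∀ i, 0 < t i ∧ t i < b) ∧ StrictAnti t} := by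
  subst h
  have hdom : (r.reindex (finCongr rfl)).domain =
      {t : Fin m → ℝ | (∀ i, 0 < t i ∧ t i < b) ∧ StrictAnti t} := by
    rw [KZ.IntegralRep.reindex_domain, hd]; rfl
  refine ⟨hdom, fun t ht => ?_⟩
  rw [← hdom] at ht
  rw [KZ.IntegralRep.reindex_integrand]
  exact hi ht

/-- Last letter of a word with `getLast? = some a`, as a `get`. [folklore] -/
theorem get_length_sub_one {α : Type*} {W : List α} {a : α} (hW : W.getLast? = some a)
    (h : W.length - 1 < W.length) : W.get ⟨W.length - 1, h⟩ = a := by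
  rw [List.getLast?_eq_getElem?, List.getElem?_eq_getElem h, Option.some.injEq] at hW
  rw [List.get_eq_getElem]
  exact hW

/-- A word ending in `true` is non-empty: its last index. [folklore] -/
theorem length_sub_one_lt {W : List Bool} (hW : W.getLast? = some true) :
    W.length - 1 < W.length := by
  have hWne : W ≠ [] := by rintro rfl; simp at hW
  have := List.length_pos_iff.mpr hWne
  omega

/-- For a word `W` ending in `true`, the two-letter words `u` of the same length with a non-zero
coefficient `∏ᵢ cz(uᵢ, Wᵢ)` end in `true` (`cz(0, 1) = 0`). [folklore] -/
theorem apply_last_eq_true {W : List Bool} (hW : W.getLast? = some true) (u : Fin W.length → Bool)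
    (h : (∏ i, (if u i then -1 else if W.get i then 0 else 1 : ℤ)) ≠ 0) :
    u ⟨W.length - 1, length_sub_one_lt hW⟩ = true := by
  by_contra hc
  refine h (Finset.prod_eq_zero (Finset.mem_univ (⟨W.length - 1, length_sub_one_lt hW⟩ :
    Fin W.length)) ?_)
  rw [get_length_sub_one hW, Bool.eq_false_iff.mpr hc]; rfl

/-- … hence the corresponding word over `Fin 3` does not end in the letter `0`. [folklore] -/
theorem getLast?_ofFn_map_emb {W : List Bool} (hW : W.getLast? = some true)
    (u : Fin W.length → Bool)
    (h : (∏ i, (if u i then -1 else if W.get i then 0 else 1 : ℤ)) ≠ 0) :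
    ((List.ofFn u).map (fun b => if b then (1 : Fin 3) else 0)).getLast? ≠ some 0 := by
  have hn := length_sub_one_lt hW
  have : ((List.ofFn u).map (fun b => if b then (1 : Fin 3) else 0)).getLast? =
      some (if u ⟨W.length - 1, hn⟩ then (1 : Fin 3) else 0) := by
    simp [List.getLast?_eq_getElem?, hn]
  rw [this, apply_last_eq_true hW u h]; decide

/-- **The convergent-word identity of the chart `s = τ/(1-τ)`** for the atlas: for a two-letter
word `W` ending in the letter `1`, `[I 10 W] - Σ_u (∏ᵢ cz(uᵢ, Wᵢ)) [I 5 u] ∈ KZ.relations`, the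
sum running over the two-letter words `u` of the same length (those with a non-zero coefficient
end in the letter `1`) — the sub-stub `chartB_core` on the reindexed representations.
[cite: KontsevichZagier2001, §1.2 rules (1), (2)] -/
theorem of_I10_sub_sum_mem_relations
    (I : (p : Fin 15) → (w : List (Fin 3)) → KZ.IntegralRep w.length)
    (hI : ∀ (p : Fin 15) (w : List (Fin 3)), w.getLast? ≠ some 0 → (I p w).domain = {t | (∀ i, 0 < t i ∧ t i < (![1/2, 1/2, 1/2, 1/2, 1/2, 1/2, 1/2, 1/2, 1/2, 1/2, 1, 1, 1/2, 1/2, 1/2] : Fin 15 → ℝ) p) ∧ StrictAnti t} ∧ Set.EqOn (I p w).integrand (fun t => ∏ i, 1 / (t i - (![![0, 1, 2], ![0, 1, -1], ![0, 1, 2], ![0, 1, -1], ![0, 1, 2], ![0, 1, 2], ![0, 1, 2], ![0, 1, 2], ![0, 1, 2], ![0, 1, 2], ![0, -1, 2], ![0, -1, 2], ![0, 1, 2], ![0, 1, 2], ![0, 1, 2]] : Fin 15 → Fin 3 → ℝ) p (w.get i))) (I p w).domain)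
    (W : List Bool) (hW : W.getLast? = some true) :
    KZ.of (I 10 (W.map (fun b => if b then (1 : Fin 3) else 0))) - ∑ u : Fin W.length → Bool,
      (∏ i, (if u i then -1 else if W.get i then 0 else 1 : ℤ)) •
        KZ.of (I 5 ((List.ofFn u).map (fun b => if b then (1 : Fin 3) else 0))) ∈ KZ.relations := by
  -- the letter embedding `false ↦ 0`, `true ↦ 1`
  set e : Bool → Fin 3 := fun b => if b then (1 : Fin 3) else 0 with he
  -- the path-`10` representation, reindexed to dimension `W.length`
  have h10w : (W.map e).getLast? ≠ some 0 := by rw [List.getLast?_map, hW, he]; decide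
  have hl10 : (W.map e).length = W.length := List.length_map _
  obtain ⟨h10d, h10i⟩ := hI 10 (W.map e) h10w
  set r10 : KZ.IntegralRep W.length := (I 10 (W.map e)).reindex (finCongr hl10) with hr10def
  have hr10 := reindex_finCongr hl10 (I 10 (W.map e)) 1 _ h10d h10i
  have hget10 : ∀ i : Fin W.length, (W.map e).get (Fin.cast hl10.symm i) = e (W.get i) :=
    fun i => by simp [List.getElem_map]
  have h10i' : EqOn r10.integrand (fun s => ∏ i, 1 / (s i - (if W.get i then (-1 : ℝ) else 0)))
      {t : Fin W.length → ℝ | (∀ i, 0 < t i ∧ t i < 1) ∧ StrictAnti t} := by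
    intro s hs
    rw [hr10def, hr10.2 hs]
    refine Finset.prod_congr rfl fun i _ => ?_
    rw [hget10, he]
    cases W.get i <;> rfl
  -- the path-`5` representations, reindexed to dimension `W.length`
  have hl5 : ∀ u : Fin W.length → Bool, ((List.ofFn u).map e).length = W.length := fun u => by
    simp
  set r5 : (Fin W.length → Bool) → KZ.IntegralRep W.length :=
    fun u => (I 5 ((List.ofFn u).map e)).reindex (finCongr (hl5 u)) with hr5def
  have hget5 : ∀ (u : Fin W.length → Bool) (i : Fin W.length),
      ((List.ofFn u).map e).get (Fin.cast (hl5 u).symm i) = e (u i) := fun u i => by simp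
  have h5 : ∀ u : Fin W.length → Bool,
      (∏ i, (if u i then -1 else if W.get i then 0 else 1 : ℤ)) ≠ 0 →
      (r5 u).domain = {t : Fin W.length → ℝ | (∀ i, 0 < t i ∧ t i < 1 / 2) ∧ StrictAnti t} ∧
        EqOn (r5 u).integrand (fun τ => ∏ i, 1 / (τ i - (if u i then (1 : ℝ) else 0)))
          {t : Fin W.length → ℝ | (∀ i, 0 < t i ∧ t i < 1 / 2) ∧ StrictAnti t} := by
    intro u h
    obtain ⟨h5d, h5i⟩ := hI 5 ((List.ofFn u).map e) (he ▸ getLast?_ofFn_map_emb hW u h)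
    have hr5 := reindex_finCongr (hl5 u) (I 5 ((List.ofFn u).map e)) (1 / 2) _ h5d h5i
    refine ⟨hr5.1, fun τ hτ => ?_⟩
    rw [hr5def, hr5.2 hτ]
    refine Finset.prod_congr rfl fun i _ => ?_
    rw [hget5, he]
    cases u i <;> rfl
  -- the core identity, and the reindexing relations
  have hcore := chartB_core W.length (fun i => W.get i) r10 hr10.1 h10i' r5 h5
  have hre10 : KZ.of (I 10 (W.map e)) - KZ.of r10 ∈ KZ.relations :=
    KZ.of_sub_of_reindex_mem_relations _ _
  have hre5 : ∑ u : Fin W.length → Bool,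
      (∏ i, (if u i then -1 else if W.get i then 0 else 1 : ℤ)) •
        (KZ.of (I 5 ((List.ofFn u).map e)) - KZ.of (r5 u)) ∈ KZ.relations :=
    sum_mem fun u _ => KZ.relations.zsmul_mem (KZ.of_sub_of_reindex_mem_relations _ _) _
  have : KZ.of (I 10 (W.map e)) - ∑ u : Fin W.length → Bool,
      (∏ i, (if u i then -1 else if W.get i then 0 else 1 : ℤ)) • KZ.of (I 5 ((List.ofFn u).map e)) =
      (KZ.of (I 10 (W.map e)) - KZ.of r10) +
        (KZ.of r10 -
          ∑ u, (∏ i, (if u i then -1 else if W.get i then 0 else 1 : ℤ)) • KZ.of (r5 u)) -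
        ∑ u : Fin W.length → Bool, (∏ i, (if u i then -1 else if W.get i then 0 else 1 : ℤ)) •
          (KZ.of (I 5 ((List.ofFn u).map e)) - KZ.of (r5 u)) := by
    simp only [smul_sub, Finset.sum_sub_distrib]; abel
  rw [this]
  exact KZ.relations.sub_mem (KZ.relations.add_mem hre10 hcore) hre5

/-! ### Restriction of three-letter series to two-letter words -/

section Algebra

variable {R : Type} [CommRing R]

/-- The restriction along the letter embedding `false ↦ 0`, `true ↦ 1` (the pushforward along
its `0/1` matrix) reads the coefficients of the embedded words. [folklore] -/
theorem push_mE_apply (S : NCSeries (Fin 3) R) :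
    ∀ W : List Bool, NCSeries.push (fun (a : Fin 3) (b : Bool) =>
      if a = (if b then (1 : Fin 3) else 0) then (1 : R) else 0) S W =
        S (W.map (fun b => if b then (1 : Fin 3) else 0))
  | [] => by simp
  | b :: W => by
    rw [NCSeries.push_cons, Finset.sum_eq_single (if b then (1 : Fin 3) else 0)]
    · rw [push_mE_apply (NCSeries.lderiv (if b then (1 : Fin 3) else 0) S) W]
      simp
    · intro a _ ha
      simp [ha]
    · simp

/-- **Evaluation at `(x, y, 0)` is evaluation of the restriction at `(x, y)`.** [folklore] -/
theorem evalTrunc_vec3_eq {A : Type*} [Ring A] [Algebra R A] (N : ℕ) (x y : A)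
    (S : NCSeries (Fin 3) R) :
    NCSeries.evalTrunc N (![x, y, 0] : Fin 3 → A) S =
      NCSeries.evalTrunc N (NCSeries.bsub x y) (NCSeries.push (fun (a : Fin 3) (b : Bool) =>
      if a = (if b then (1 : Fin 3) else 0) then (1 : R) else 0) S) := by
  rw [NCSeries.evalTrunc_push]
  congr 1
  funext a
  fin_cases a <;> simp [NCSeries.bsub]

/-- The integer letter matrix `NCSeries.mXZ` of `x₀ ↦ x₀`, `x₁ ↦ -x₀ - x₁` is `cz`. [folklore] -/
theorem mXZ_eq_cz (a b : Bool) :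
    (NCSeries.mXZ a b : R) = ((if a then -1 else if b then 0 else 1 : ℤ) : R) := by
  cases a <;> cases b <;> simp [NCSeries.mXZ]

/-! ### Two values of the end regularisation -/

/-- A word not ending in `x` is untouched by the end regularisation at `x`.
[cite: IharaKanekoZagier2006, Cor. 5] -/
theorem regEnd_eq_single {α : Type*} [DecidableEq α] (x : α) {w : List α}
    (hw : w.getLast? ≠ some x) : Shuffle.regEnd x w = Finsupp.single w 1 := by
  unfold Shuffle.regEnd Shuffle.regFront
  have hl : Shuffle.leadCount x w.reverse = 0 := by
    cases h : w.reverse with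
    | nil => rfl
    | cons a v =>
      have ha : w.getLast? = some a := by rw [← List.head?_reverse, h]; rfl
      exact Shuffle.leadCount_cons_of_ne (fun hax : a = x => hw (by rw [ha, hax])) v
  rw [hl, Finset.sum_range_one]
  simp

/-- `regEnd_x(x) = 0`: the end-regularised series have no coefficient on the letter `x`.
[cite: IharaKanekoZagier2006, Cor. 5] -/
theorem regEnd_singleton_self {α : Type*} [DecidableEq α] (x : α) :
    Shuffle.regEnd x [x] = 0 := by
  rw [Shuffle.regEnd, show ([x] : List α).reverse = [x] from rfl]
  have : Shuffle.regFront x [x] = 0 := by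
    rw [Shuffle.regFront, Shuffle.leadCount_cons_self, Shuffle.leadCount_nil, Finset.sum_range_succ,
      Finset.sum_range_succ, Finset.sum_range_zero]
    simp [Shuffle.shuffleSum, Shuffle.wordSum]
  simp [this]

/-! ### Exponentials of letters under evaluation -/

/-- **Exponentials of letters evaluate to truncated exponentials**: `ev_Z(exp(ℓ c)) = e^{ℓ Z_c}`
on a nilpotent substitution (the tree's `evalTrunc_expLetter`, over a general `ℚ`-algebra).
[folklore] -/
theorem evalTrunc_expLetter [Algebra ℚ R] {A : Type*} [Ring A] [Algebra R A] (N : ℕ)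
    (Z : Bool → A) (hZ : ∀ w : List Bool, N < w.length → (w.map Z).prod = 0) (c : Bool) (ℓ : R) :
    NCSeries.evalTrunc N Z (Shuffle.expLetter c ℓ) = truncExp R N (ℓ • Z c) := by
  rw [Shuffle.expLetter_eq_exp, NCSeries.evalTrunc_exp N Z hZ (by simp), truncExp]
  refine Finset.sum_congr rfl fun m _ => ?_
  rw [NCSeries.monomial_singleton_eq_smul, NCSeries.evalTrunc_smul, NCSeries.evalTrunc_letter N Z hZ]

end Algebra

end ChartB

open ChartB in
/-- **Stub `stub_chartB`** [M]: the CHART IDENTITY between the two half-edge families. With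
`B(X,W) := (P 10)(X, W, 0)` the log-free transport of `X ds/s + W ds/(s+1)` over `(0, 1)` from the
tangential base point at `0` (paths 10, 11: the edge `t₁₂ — t₂₃` read in the charts
`s = τ/(1-τ)` centred at its two vertices, midpoint at `s = 1`): `B(X,W) = A(X, -X-W) · e^{λX}`
for all weight-one `X, W` — the change of variables `s = τ/(1-τ)` (`ds/s = dτ/τ - dτ/(τ-1)`,
`ds/(s+1) = -dτ/(τ-1)`, integrand additivity) on words not ending in `0`
(`ChartB.of_I10_sub_sum_mem_relations`), extended to all words by the end-regularisation
algebra of the two group-like series: both `B` and `θ^*A · e^{λ x₀}` (`θ : x₀ ↦ x₀ - x₁,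
x₁ ↦ -x₁`, `NCSeries.push NCSeries.mXZ`) are group-like with no coefficient on `x₀` and agree on
the words not ending in `x₀`, hence agree (`Shuffle.pair_regEnd`); the factor `e^{λX}` is the
change of scale `log 1 = 0` versus `log ½` at the endpoint. [folklore] -/
theorem stub_chartB :
    ∀ (R : Type) [CommRing R] [Algebra ℚ R] (χ : KZ.FormalRep →+ R), (∀ c ∈ KZ.relations, χ c = 0) → (∀ x y : KZ.FormalRep, χ (x * y) = χ x * χ y) → (∃ u : KZ.FormalRep, χ u = 1) → ∀ (I : (p : Fin 15) → (w : List (Fin 3)) → KZ.IntegralRep w.length), (∀ (p : Fin 15) (w : List (Fin 3)), w.getLast? ≠ some 0 → (I p w).domain = {t | (∀ i, 0 < t i ∧ t i < (![1/2, 1/2, 1/2, 1/2, 1/2, 1/2, 1/2, 1/2, 1/2, 1/2, 1, 1, 1/2, 1/2, 1/2] : Fin 15 → ℝ) p) ∧ StrictAnti t} ∧ Set.EqOn (I p w).integrand (fun t => ∏ i, 1 / (t i - (![![0, 1, 2], ![0, 1, -1], ![0, 1, 2], ![0, 1, -1], ![0, 1, 2], ![0, 1, 2], ![0, 1, 2],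 ![0, 1, 2], ![0, 1, 2], ![0, 1, 2], ![0, -1, 2], ![0, -1, 2], ![0, 1, 2], ![0, 1, 2], ![0, 1, 2]] : Fin 15 → Fin 3 → ℝ) p (w.get i))) (I p w).domain) → ∀ (P : Fin 15 → NCSeries (Fin 3) R), (∀ (p : Fin 15) (W : List (Fin 3)), P p W = if W = [] then 1 else Shuffle.pair (fun w => χ (KZ.of (I p w))) (Shuffle.regEnd 0 W)) → (∀ p : Fin 15, NCSeries.IsGroupLike (P p)) → ∀ (N : ℕ) (x w : DrinfeldKohnoTrunc R (Fin 4) N), x ∈ (DrinfeldKohnoTrunc.genSpan : Submodule R (DrinfeldKohnoTrunc R (Fin 4) N)) → w ∈ (DrinfeldKohnoTrunc.genSpan : Submodule R (DrinfeldKohnoTrunc R (Fin 4) N)) → NCSeries.evalTrunc N (![x, w, 0] : Fin 3 → DrinfeldKohnoTrunc R (Fin 4) N) (P 10) = NCSeries.evalTrunc N (![x, -x - w, 0] : Fin 3 → DrinfeldKohnoTrunc R (Fin 4) N) (P 5) * truncExp R N (χ (KZ.of (I 5 [1])) • x) := by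
  intro R _ _ χ hrel _hmul _hunit I hI P hP hG N x w hx hw
  classical
  -- the two-letter restrictions `G_A`, `G_B`, the scale `λ` and the model `T = θ^*G_A · e^{λ x₀}`
  set mEmb : Fin 3 → Bool → R := fun a b => if a = (if b then (1 : Fin 3) else 0) then 1 else 0
    with hmEmb
  set GA : NCSeries Bool R := NCSeries.push mEmb (P 5) with hGA
  set GB : NCSeries Bool R := NCSeries.push mEmb (P 10) with hGB
  set L : R := χ (KZ.of (I 5 [1])) with hL
  set T : NCSeries Bool R := NCSeries.push NCSeries.mXZ GA * Shuffle.expLetter false L with hT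
  have hGAg : NCSeries.IsGroupLike GA := (hG 5).push _
  have hGBg : NCSeries.IsGroupLike GB := (hG 10).push _
  have hTg : NCSeries.IsGroupLike T := (hGAg.push _).mul (Shuffle.isGroupLike_expLetter _ _)
  have hGA_apply : ∀ W, GA W = P 5 (W.map (fun b => if b then (1 : Fin 3) else 0)) := push_mE_apply _
  have hGB_apply : ∀ W, GB W = P 10 (W.map (fun b => if b then (1 : Fin 3) else 0)) := push_mE_apply _
  -- coefficients of the transports on short words
  have hP0 : ∀ p, P p [0] = 0 := fun p => by
    rw [hP, if_neg (List.cons_ne_nil _ _), regEnd_singleton_self, Shuffle.pair_zero]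
  have hPconv : ∀ (p : Fin 15) (v : List (Fin 3)), v ≠ [] → v.getLast? ≠ some 0 →
      P p v = χ (KZ.of (I p v)) := fun p v h1 h2 => by
    rw [hP, if_neg h1, regEnd_eq_single 0 h2, Shuffle.pair_single, one_smul]
  have hGB0 : GB [false] = 0 := by rw [hGB_apply]; exact hP0 10
  have hGA0 : GA [false] = 0 := by rw [hGA_apply]; exact hP0 5
  have hGA1 : GA [true] = L := by
    rw [hGA_apply]
    exact hPconv 5 [1] (List.cons_ne_nil _ _) (by decide)
  have hT0 : T [false] = 0 := by
    rw [hT, Shuffle.mul_apply_singleton, NCSeries.push_nil, Shuffle.expLetter_singleton_self,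
      Shuffle.expLetter_nil, NCSeries.push_cons, Fintype.sum_bool, NCSeries.push_nil,
      NCSeries.push_nil, NCSeries.lderiv_apply, NCSeries.lderiv_apply, hGA0, hGA1, hGAg.1]
    simp [NCSeries.mXZ]
  -- agreement on the words not ending in `x₀`: the change of variables
  have hagree : ∀ W : List Bool, W.getLast? ≠ some false → GB W = T W := by
    intro W hW
    rcases W.eq_nil_or_concat with rfl | ⟨W₀, b, rfl⟩
    · rw [hGBg.1, hTg.1]
    · obtain rfl : b = true := by
        cases b
        · exact absurd (by simp) hW
        · rfl
      have hWl : (W₀.concat true).getLast? = some true := by simp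
      have hWne : (W₀.concat true) ≠ [] := by simp
      set W := W₀.concat true with hWdef
      rw [hT, Shuffle.mul_expLetter_apply_of_getLast?_ne false L _ hW, hGB_apply,
        hPconv 10 _ (by simpa using hWne) (by rw [List.getLast?_map, hWl]; decide)]
      have hpush : NCSeries.push NCSeries.mXZ GA W =
          ∑ u : Fin W.length → Bool, GA (List.ofFn u) * ∏ i, NCSeries.mXZ (u i) (W.get i) := by
        have := NCSeries.push_ofFn NCSeries.mXZ W.length GA W.get
        rwa [List.ofFn_get] at this
      have hA := hrel _ (of_I10_sub_sum_mem_relations I hI W hWl)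
      rw [map_sub, sub_eq_zero, map_sum] at hA
      rw [hpush, hA]
      refine Finset.sum_congr rfl fun u _ => ?_
      have hprod : (∏ i, NCSeries.mXZ (u i) (W.get i) : R) =
          ((∏ i, (if u i then -1 else if W.get i then 0 else 1 : ℤ) : ℤ) : R) := by
        rw [Int.cast_prod]
        exact Finset.prod_congr rfl fun i _ => mXZ_eq_cz _ _
      rw [map_zsmul, hprod, hGA_apply]
      by_cases hc : (∏ i, (if u i then -1 else if W.get i then 0 else 1 : ℤ)) = 0
      · rw [hc, zero_smul, Int.cast_zero, mul_zero]
      · have hne : (List.ofFn u).map (fun b => if b then (1 : Fin 3) else 0) ≠ [] :=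
          List.ne_nil_of_length_pos (by
            rw [List.length_map, List.length_ofFn]; have := length_sub_one_lt hWl; omega)
        rw [hPconv 5 _ hne (getLast?_ofFn_map_emb hWl u hc), zsmul_eq_mul, mul_comm]
  -- the two group-like series with no `x₀`-coefficient agree
  have hGBT : GB = T := by
    funext W
    rw [← Shuffle.pair_regEnd hGBg hGB0 W, ← Shuffle.pair_regEnd hTg hT0 W]
    exact Shuffle.pair_congr fun v hv =>
      hagree v (Shuffle.getLast?_ne_of_mem_support_regEnd false W hv)
  -- evaluate
  have hnil : ∀ v : List Bool, N < v.length → (v.map (NCSeries.bsub x w)).prod = 0 :=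
    DrinfeldKohnoTrunc.prod_map_eq_zero_of_mem_genSpan (NCSeries.bsub x w)
      (fun b => by cases b <;> simp [hx, hw])
  rw [evalTrunc_vec3_eq, evalTrunc_vec3_eq, ← hmEmb, ← hGB, ← hGA, hGBT, hT,
    NCSeries.evalTrunc_mul N _ hnil, NCSeries.evalTrunc_push_mXZ, evalTrunc_expLetter N _ hnil]
  rfl

end Summit.KontsevichZagierPeriods.FurushoPentagon.PentagonInKZ
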